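import Summits.NavierStokesRegularity.NavierStokesRegularity.Theorems.SwirlHolderTowerFunnel
import Summits.NavierStokesRegularity.NavierStokesRegularity.Theorems.SwirlHolderTowerFunnelCalculus
import Literature.Analysis.FluidPDE.SverakLandauConformalCalc
import HarnessLib

/-!
# SwirlHolderTower, part 3b — the funnel drift: decomposition, smoothness, `div u_N = 0`,
# `|u_N| ≤ N/|x|` (ROUND-15 typing request T-15.3, second half; seat nsreg-p4)

Support file for the DORMANT route `SwirlThreshold` (crux stmt-NavierStokesRegularity-2002):
the classical facts about the FUNNEL drift
`u_N(x) = N (2|x|⁴)⁻¹ (x₁(x₃² - x₁² - x₂²), x₂(x₃² - x₁² - x₂²), 2x₃³)` (`funnelDrift N` of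
`…Theorems.SwirlHolderTowerFunnel`) that enter the hypothesis package `FunnelSeparation` of the
kernel ceiling `linearHolderLaw_ceiling`:

* `funnelDrift_eq_smul_add`: `u_N(y) = a(y) y + b(y) e₂` with `a = N(2y₂² - ‖y‖²)/(2‖y‖⁴)`,
  `b = N y₂/(2‖y‖²)` (all `y`; `e₂ = EuclideanSpace.single 2 1` is the axis direction);
* `contDiffOn_funnelDrift`: `u_N` is `C^∞` on `ℝ³ ∖ {0}`;
* `divergence_funnelDrift`: **`div u_N = 0`** on `ℝ³ ∖ {0}` (`= 3a + x·∇a + ∂₂b = 3a - 2a - a`,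
  pointwise trace calculus `divergence_smul_pt`, `Sverak2011.divergence_id_three`);
* `inner_self_funnelDrift` (`⟪x, u_N(x)⟫ = N(3x₂² - ‖x‖²)/(2‖x‖²) = N P₂(cos ϑ)`),
  `funnelDrift_apply_two` (`(u_N)₂ = N x₂³/‖x‖⁴`), `inner_self_eR` (`⟪x, e_r⟫ = r`), `eR_apply_two`;
* `norm_funnelDrift_le`: **`|u_N(x)| ≤ N/|x|`** for `N ≥ 0` (`3a³ + 14a²b + 11ab² ≥ 0`).

WHAT THIS IS NOT: not NS regularity — the funnel is a steady `-1`-homogeneous divergence-free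
DRIFT (not a Navier–Stokes flow) calibrating LINEAR methods; hard cores untouched; no crux claim.
-/

namespace Summit.NavierStokesRegularity.NavierStokesRegularity.Theorems.SwirlHolderTower

open Set Filter Topology WithLp Module
open scoped Laplacian RealInnerProductSpace
open Literature.Analysis Literature.Analysis.FluidPDE

noncomputable section


/-- `div (c • T)(x) = c(x) div T(x) + Dc(x)(T x)` at a point of differentiability. -/
theorem divergence_smul_pt {c : EuclideanSpace ℝ (Fin 3) → ℝ}
    {T : EuclideanSpace ℝ (Fin 3) → EuclideanSpace ℝ (Fin 3)} {x : EuclideanSpace ℝ (Fin 3)}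
    (hc : DifferentiableAt ℝ c x) (hT : DifferentiableAt ℝ T x) :
    VectorCalculus.divergence (fun y => c y • T y) x =
      c x * VectorCalculus.divergence T x + fderiv ℝ c x (T x) := by
  simp only [VectorCalculus.divergence]
  rw [fderiv_fun_smul hc hT, ContinuousLinearMap.toLinearMap_add, map_add,
    ContinuousLinearMap.toLinearMap_smul, map_smul,
    show (((fderiv ℝ c x).smulRight (T x) : EuclideanSpace ℝ (Fin 3) →L[ℝ] EuclideanSpace ℝ (Fin 3)) :
      EuclideanSpace ℝ (Fin 3) →ₗ[ℝ] EuclideanSpace ℝ (Fin 3)) =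
      (fderiv ℝ c x : EuclideanSpace ℝ (Fin 3) →ₗ[ℝ] ℝ).smulRight (T x) from rfl,
    LinearMap.trace_smulRight, smul_eq_mul]
  rfl

/-- `div (constant) = 0`. -/
theorem divergence_fun_const (v x : EuclideanSpace ℝ (Fin 3)) :
    VectorCalculus.divergence (fun _ : EuclideanSpace ℝ (Fin 3) => v) x = 0 := by
  simp only [VectorCalculus.divergence]
  rw [fderiv_fun_const]
  simp


/-! ### The funnel drift as `a(y) • y + b(y) • e₂` -/

/-- **Decomposition of the funnel drift**: `u_N(y) = a(y) y + b(y) e₂` with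
`a(y) = N(2y₂² - ‖y‖²)/(2‖y‖⁴)` and `b(y) = N y₂/(2‖y‖²)` (valid at every `y`, both sides
vanishing at the origin). -/
theorem funnelDrift_eq_smul_add (N : ℝ) (y : EuclideanSpace ℝ (Fin 3)) :
    funnelDrift N y =
      (N / 2 * (2 * y 2 ^ 2 - ‖y‖ ^ 2) * (‖y‖ ^ 2) ^ (-2 : ℝ)) • y +
        (N / 2 * y 2 * (‖y‖ ^ 2) ^ (-1 : ℝ)) • EuclideanSpace.single 2 1 := by
  have h4 : (‖y‖ ^ 2) ^ (-2 : ℝ) = (‖y‖ ^ 4)⁻¹ := by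
    rw [Real.rpow_neg (sq_nonneg _), Real.rpow_two]; ring
  have h1 : (‖y‖ ^ 2) ^ (-1 : ℝ) = (‖y‖ ^ 2)⁻¹ := Real.rpow_neg_one _
  rw [h4, h1]
  have h3 := EuclideanSpace.real_norm_sq_eq y
  rw [Fin.sum_univ_three] at h3
  by_cases hy : y = 0
  · subst hy; simp [funnelDrift]
  have hρ : 0 < ‖y‖ := norm_pos_iff.mpr hy
  ext i
  fin_cases i
  · simp [funnelDrift]
    field_simp
    linear_combination (N * y 0) * h3
  · simp [funnelDrift]
    field_simp
    linear_combination (N * y 1) * h3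
  · simp [funnelDrift]
    field_simp
    ring

/-- The radial coefficient `a` is smooth at `x ≠ 0`. -/
theorem contDiffAt_funnelCoefA (N : ℝ) {n : WithTop ℕ∞} {x : EuclideanSpace ℝ (Fin 3)} (hx : x ≠ 0) :
    ContDiffAt ℝ n (fun y : EuclideanSpace ℝ (Fin 3) =>
      N / 2 * (2 * y 2 ^ 2 - ‖y‖ ^ 2) * (‖y‖ ^ 2) ^ (-2 : ℝ)) x := by
  have hσ : (‖x‖ ^ 2) ≠ 0 := (pow_pos (norm_pos_iff.mpr hx) 2).ne'
  have h2 : ContDiffAt ℝ n (fun y : EuclideanSpace ℝ (Fin 3) => y 2) x :=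
    (EuclideanSpace.proj (2 : Fin 3) : EuclideanSpace ℝ (Fin 3) →L[ℝ] ℝ).contDiff.contDiffAt
  have hn : ContDiffAt ℝ n (fun y : EuclideanSpace ℝ (Fin 3) => ‖y‖ ^ 2) x :=
    (contDiff_norm_sq ℝ).contDiffAt
  exact (contDiffAt_const.mul ((contDiffAt_const.mul (h2.pow 2)).sub hn)).mul (hn.rpow_const_of_ne hσ)

/-- The axial coefficient `b` is smooth at `x ≠ 0`. -/
theorem contDiffAt_funnelCoefB (N : ℝ) {n : WithTop ℕ∞} {x : EuclideanSpace ℝ (Fin 3)} (hx : x ≠ 0) :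
    ContDiffAt ℝ n (fun y : EuclideanSpace ℝ (Fin 3) => N / 2 * y 2 * (‖y‖ ^ 2) ^ (-1 : ℝ)) x := by
  have hσ : (‖x‖ ^ 2) ≠ 0 := (pow_pos (norm_pos_iff.mpr hx) 2).ne'
  have h2 : ContDiffAt ℝ n (fun y : EuclideanSpace ℝ (Fin 3) => y 2) x :=
    (EuclideanSpace.proj (2 : Fin 3) : EuclideanSpace ℝ (Fin 3) →L[ℝ] ℝ).contDiff.contDiffAt
  have hn : ContDiffAt ℝ n (fun y : EuclideanSpace ℝ (Fin 3) => ‖y‖ ^ 2) x :=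
    (contDiff_norm_sq ℝ).contDiffAt
  exact (contDiffAt_const.mul h2).mul (hn.rpow_const_of_ne hσ)

/-- **The funnel drift is smooth off the origin.** -/
theorem contDiffOn_funnelDrift (N : ℝ) {n : WithTop ℕ∞} :
    ContDiffOn ℝ n (funnelDrift N) {x : EuclideanSpace ℝ (Fin 3) | x ≠ 0} := by
  intro x hx
  have h : funnelDrift N = fun y : EuclideanSpace ℝ (Fin 3) =>
      (N / 2 * (2 * y 2 ^ 2 - ‖y‖ ^ 2) * (‖y‖ ^ 2) ^ (-2 : ℝ)) • y +
        (N / 2 * y 2 * (‖y‖ ^ 2) ^ (-1 : ℝ)) • EuclideanSpace.single 2 1 :=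
    funext (funnelDrift_eq_smul_add N)
  rw [h]
  exact (((contDiffAt_funnelCoefA N hx).smul contDiffAt_id).add
    ((contDiffAt_funnelCoefB N hx).smul contDiffAt_const)).contDiffWithinAt

/-- Derivative of the radial coefficient along `x`: `Da(x)(x) = -2 a(x)` (`a` is homogeneous of
degree `-2`). -/
theorem fderiv_funnelCoefA_self (N : ℝ) {x : EuclideanSpace ℝ (Fin 3)} (hx : x ≠ 0) :
    fderiv ℝ (fun y : EuclideanSpace ℝ (Fin 3) =>
        N / 2 * (2 * y 2 ^ 2 - ‖y‖ ^ 2) * (‖y‖ ^ 2) ^ (-2 : ℝ)) x x =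
      -2 * (N / 2 * (2 * x 2 ^ 2 - ‖x‖ ^ 2) * (‖x‖ ^ 2) ^ (-2 : ℝ)) := by
  have hρ : 0 < ‖x‖ := norm_pos_iff.mpr hx
  have hσ : 0 < ‖x‖ ^ 2 := pow_pos hρ 2
  have h2 : HasFDerivAt (fun y : EuclideanSpace ℝ (Fin 3) => y 2)
      (EuclideanSpace.proj (2 : Fin 3) : EuclideanSpace ℝ (Fin 3) →L[ℝ] ℝ) x :=
    (EuclideanSpace.proj (2 : Fin 3) : EuclideanSpace ℝ (Fin 3) →L[ℝ] ℝ).hasFDerivAt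
  have hn := (hasStrictFDerivAt_norm_sq x).hasFDerivAt
  have hq := hasFDerivAt_norm_sq_rpow (-2 : ℝ) hx
  have h := (((h2.pow 2).const_mul (2:ℝ)).fun_sub hn).const_mul (N / 2) |>.fun_mul hq
  rw [h.fderiv]
  simp only [add_apply, FunLike.coe_smul, Pi.smul_apply, innerSL_apply_apply, PiLp.proj_apply,
    FunLike.coe_sub, Pi.sub_apply, smul_eq_mul, real_inner_self_eq_norm_sq]
  simp only [nsmul_eq_mul, Nat.cast_ofNat]
  rw [Real.rpow_sub_one hσ.ne']
  have h4 : (‖x‖ ^ 2) ^ (-2 : ℝ) = (‖x‖ ^ 4)⁻¹ := by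
    rw [Real.rpow_neg (sq_nonneg _), Real.rpow_two]; ring
  rw [h4]
  push_cast
  field_simp
  ring


/-- Derivative of the axial coefficient along `e₂`: `Db(x)(e₂) = -a(x)`. -/
theorem fderiv_funnelCoefB_single_two (N : ℝ) {x : EuclideanSpace ℝ (Fin 3)} (hx : x ≠ 0) :
    fderiv ℝ (fun y : EuclideanSpace ℝ (Fin 3) => N / 2 * y 2 * (‖y‖ ^ 2) ^ (-1 : ℝ)) x
        (EuclideanSpace.single 2 1) =
      -(N / 2 * (2 * x 2 ^ 2 - ‖x‖ ^ 2) * (‖x‖ ^ 2) ^ (-2 : ℝ)) := by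
  have hρ : 0 < ‖x‖ := norm_pos_iff.mpr hx
  have hσ : 0 < ‖x‖ ^ 2 := pow_pos hρ 2
  have h2 : HasFDerivAt (fun y : EuclideanSpace ℝ (Fin 3) => y 2)
      (EuclideanSpace.proj (2 : Fin 3) : EuclideanSpace ℝ (Fin 3) →L[ℝ] ℝ) x :=
    (EuclideanSpace.proj (2 : Fin 3) : EuclideanSpace ℝ (Fin 3) →L[ℝ] ℝ).hasFDerivAt
  have h := (h2.const_mul (N / 2)).fun_mul (hasFDerivAt_norm_sq_rpow (-1 : ℝ) hx)
  rw [h.fderiv]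
  simp only [add_apply, FunLike.coe_smul, Pi.smul_apply, innerSL_apply_apply, PiLp.proj_apply,
    EuclideanSpace.inner_single_right, conj_trivial, PiLp.single_apply, smul_eq_mul]
  simp only [Fin.isValue, ↓reduceIte, mul_one]
  rw [Real.rpow_sub_one hσ.ne', Real.rpow_neg_one]
  have h4 : (‖x‖ ^ 2) ^ (-2 : ℝ) = (‖x‖ ^ 4)⁻¹ := by
    rw [Real.rpow_neg (sq_nonneg _), Real.rpow_two]; ring
  rw [h4]
  field_simp
  ring

/-- **The funnel drift is divergence free** on `ℝ³ ∖ {0}`: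
`div u_N = 3a + x·∇a + ∂₂b = 3a - 2a - a = 0`. -/
theorem divergence_funnelDrift (N : ℝ) {x : EuclideanSpace ℝ (Fin 3)} (hx : x ≠ 0) :
    VectorCalculus.divergence (funnelDrift N) x = 0 := by
  have h : funnelDrift N = fun y : EuclideanSpace ℝ (Fin 3) =>
      (N / 2 * (2 * y 2 ^ 2 - ‖y‖ ^ 2) * (‖y‖ ^ 2) ^ (-2 : ℝ)) • y +
        (N / 2 * y 2 * (‖y‖ ^ 2) ^ (-1 : ℝ)) • EuclideanSpace.single 2 1 :=
    funext (funnelDrift_eq_smul_add N)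
  have hA : DifferentiableAt ℝ (fun y : EuclideanSpace ℝ (Fin 3) =>
      N / 2 * (2 * y 2 ^ 2 - ‖y‖ ^ 2) * (‖y‖ ^ 2) ^ (-2 : ℝ)) x :=
    (contDiffAt_funnelCoefA N (n := 1) hx).differentiableAt one_ne_zero
  have hB : DifferentiableAt ℝ (fun y : EuclideanSpace ℝ (Fin 3) => N / 2 * y 2 * (‖y‖ ^ 2) ^ (-1 : ℝ)) x :=
    (contDiffAt_funnelCoefB N (n := 1) hx).differentiableAt one_ne_zero
  have hu : DifferentiableAt ℝ (fun y : EuclideanSpace ℝ (Fin 3) =>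
      (N / 2 * (2 * y 2 ^ 2 - ‖y‖ ^ 2) * (‖y‖ ^ 2) ^ (-2 : ℝ)) • y) x := hA.smul differentiableAt_id
  have hw : DifferentiableAt ℝ (fun y : EuclideanSpace ℝ (Fin 3) =>
      (N / 2 * y 2 * (‖y‖ ^ 2) ^ (-1 : ℝ)) • (EuclideanSpace.single 2 1 : EuclideanSpace ℝ (Fin 3))) x :=
    hB.smul (differentiableAt_const _)
  have hid : DifferentiableAt ℝ (fun y : EuclideanSpace ℝ (Fin 3) => y) x := differentiableAt_id
  -- `div (U + W) = div U + div W` at a point of differentiability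
  -- (cf. `Literature.Analysis.FluidPDE.EulerReynoldsLadder.divergence_add_apply`)
  have hadd : VectorCalculus.divergence (fun y : EuclideanSpace ℝ (Fin 3) =>
      (N / 2 * (2 * y 2 ^ 2 - ‖y‖ ^ 2) * (‖y‖ ^ 2) ^ (-2 : ℝ)) • y +
        (N / 2 * y 2 * (‖y‖ ^ 2) ^ (-1 : ℝ)) • EuclideanSpace.single 2 1) x =
      VectorCalculus.divergence (fun y : EuclideanSpace ℝ (Fin 3) =>
          (N / 2 * (2 * y 2 ^ 2 - ‖y‖ ^ 2) * (‖y‖ ^ 2) ^ (-2 : ℝ)) • y) x +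
        VectorCalculus.divergence (fun y : EuclideanSpace ℝ (Fin 3) =>
          (N / 2 * y 2 * (‖y‖ ^ 2) ^ (-1 : ℝ)) • (EuclideanSpace.single 2 1 : EuclideanSpace ℝ (Fin 3))) x := by
    simp only [VectorCalculus.divergence]
    rw [fderiv_fun_add hu hw, ContinuousLinearMap.toLinearMap_add, map_add]
  rw [h, hadd, divergence_smul_pt hA hid,
    divergence_smul_pt hB (differentiableAt_const (EuclideanSpace.single 2 1 : EuclideanSpace ℝ (Fin 3))),
    Sverak2011.divergence_id_three, divergence_fun_const, fderiv_funnelCoefA_self N hx,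
    fderiv_funnelCoefB_single_two N hx]
  ring

/-! ### Inner products of the drift and of the radial frame vector with `x` -/

/-- `⟪x, u_N(x)⟫ = N(3x₂² - ‖x‖²)/(2‖x‖²)` (`= N P₂(cos ϑ)`) at `x ≠ 0`. -/
theorem inner_self_funnelDrift (N : ℝ) {x : EuclideanSpace ℝ (Fin 3)} (hx : x ≠ 0) :
    ⟪x, funnelDrift N x⟫ = N * (3 * x 2 ^ 2 - ‖x‖ ^ 2) / (2 * ‖x‖ ^ 2) := by
  have hρ : 0 < ‖x‖ := norm_pos_iff.mpr hx
  have hσ : 0 < ‖x‖ ^ 2 := pow_pos hρ 2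
  rw [funnelDrift_eq_smul_add, inner_add_right, inner_smul_right, inner_smul_right,
    real_inner_self_eq_norm_sq, EuclideanSpace.inner_single_right]
  simp only [conj_trivial, one_mul]
  rw [Real.rpow_neg_one]
  have h4 : (‖x‖ ^ 2) ^ (-2 : ℝ) = (‖x‖ ^ 4)⁻¹ := by
    rw [Real.rpow_neg (sq_nonneg _), Real.rpow_two]; ring
  rw [h4]
  field_simp
  ring

/-- The axial component `(u_N(x))₂ = N x₂³/‖x‖⁴`. -/
theorem funnelDrift_apply_two (N : ℝ) (x : EuclideanSpace ℝ (Fin 3)) :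
    funnelDrift N x 2 = N * x 2 ^ 3 / ‖x‖ ^ 4 := by
  simp only [funnelDrift, PiLp.smul_apply, smul_eq_mul, Matrix.cons_val]
  ring

/-- `‖x‖² = x₀² + x₁² + x₂² = r² + x₂²` with `r = cylRadius x`. -/
theorem norm_sq_eq_cylRadius_sq_add (x : EuclideanSpace ℝ (Fin 3)) :
    ‖x‖ ^ 2 = cylRadius x ^ 2 + x 2 ^ 2 := by
  rw [EuclideanSpace.real_norm_sq_eq, Fin.sum_univ_three, cylRadius_sq]

/-- `⟪x, e_r(x)⟫ = r` off the axis. -/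
theorem inner_self_eR {x : EuclideanSpace ℝ (Fin 3)} (hx : cylRadius x ≠ 0) : ⟪x, eR x⟫ = cylRadius x := by
  rw [eR, inner_smul_right]
  simp only [PiLp.inner_apply, Fin.sum_univ_three, RCLike.inner_apply, conj_trivial,
    Matrix.cons_val_zero, Matrix.cons_val_one, Matrix.cons_val]
  have h := cylRadius_sq x
  field_simp
  linear_combination (-1) * h

/-- The radial frame vector has no axial component: `(e_r(x))₂ = 0`. -/
theorem eR_apply_two (x : EuclideanSpace ℝ (Fin 3)) : eR x 2 = 0 := by
  simp [eR, PiLp.smul_apply]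

/-- **`|u_N(x)| ≤ N/|x|`** for `N ≥ 0`, `x ≠ 0` (`r²(x₃²-r²)² + 4x₃⁶ ≤ 4|x|⁶`, i.e.
`3a³ + 14a²b + 11ab² ≥ 0` with `a = r²`, `b = x₃²`). -/
theorem norm_funnelDrift_le {N : ℝ} (hN : 0 ≤ N) {x : EuclideanSpace ℝ (Fin 3)} (hx : x ≠ 0) :
    ‖funnelDrift N x‖ ≤ N / ‖x‖ := by
  have hρ : 0 < ‖x‖ := norm_pos_iff.mpr hx
  unfold funnelDrift
  rw [norm_smul, Real.norm_eq_abs, abs_of_nonneg (by positivity)]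
  set V : EuclideanSpace ℝ (Fin 3) := toLp 2 ![x 0 * (x 2 ^ 2 - x 0 ^ 2 - x 1 ^ 2),
    x 1 * (x 2 ^ 2 - x 0 ^ 2 - x 1 ^ 2), 2 * x 2 ^ 3] with hV
  have hVsq : ‖V‖ ^ 2 = (x 0 ^ 2 + x 1 ^ 2) * (x 2 ^ 2 - (x 0 ^ 2 + x 1 ^ 2)) ^ 2 + 4 * (x 2 ^ 2) ^ 3 := by
    rw [EuclideanSpace.real_norm_sq_eq, Fin.sum_univ_three]
    simp only [hV, PiLp.toLp_apply, Matrix.cons_val_zero, Matrix.cons_val_one, Matrix.cons_val]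
    ring
  have hVle : ‖V‖ ≤ 2 * ‖x‖ ^ 3 := by
    rw [← pow_le_pow_iff_left₀ (norm_nonneg V) (by positivity) two_ne_zero, hVsq]
    have h3 : (2 * ‖x‖ ^ 3) ^ 2 = 4 * (x 0 ^ 2 + x 1 ^ 2 + x 2 ^ 2) ^ 3 := by
      rw [show (2 * ‖x‖ ^ 3) ^ 2 = 4 * (‖x‖ ^ 2) ^ 3 by ring, EuclideanSpace.real_norm_sq_eq,
        Fin.sum_univ_three]
    rw [h3]
    set a := x 0 ^ 2 + x 1 ^ 2 with ha
    set b := x 2 ^ 2 with hb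
    have ha0 : 0 ≤ a := by positivity
    have hb0 : 0 ≤ b := by positivity
    nlinarith [mul_nonneg ha0 hb0, mul_nonneg (mul_nonneg ha0 ha0) hb0,
      mul_nonneg (mul_nonneg ha0 hb0) hb0, pow_nonneg ha0 3]
  calc N / (2 * ‖x‖ ^ 4) * ‖V‖ ≤ N / (2 * ‖x‖ ^ 4) * (2 * ‖x‖ ^ 3) := by gcongr
    _ = N / ‖x‖ := by field_simp

end

end Summit.NavierStokesRegularity.NavierStokesRegularity.Theorems.SwirlHolderTower
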